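import Summits.BirchSwinnertonDyer.BirchSwinnertonDyer.Theorems.ManinLocalTwoThreeEtaIdentityReductionFortyEight
import HarnessLib

/-!
# Level 48: the three `q`-limits give the `η`-identities of `X₀(48) → 48a1` and (S2)₄₈ `Λ(φ₄₈) ⊆ Λ(52/3, 280/27)`

Cell bsd-f2-manin, route `ManinLocalTwoThree` (crux C2 `ManinOddAtFour`, stmt-22967: `2² ∣ 48`), prover seat p2 gen 26; sequel to
`EtaIdentityReductionFortyEight` (the cusp-form argument with the cusp `1/24` handled by the `W = (1 0; 24 1)`-symmetry), same namespace.
With `x = η₈⁴η₁₂²/(η₄²η₂₄⁴)`, `y = η₂η₆η₈³η₁₂²/(η₄²η₂₄⁵)`, `φ₄₈ = η₄⁴η₁₂⁴/(η₂η₆η₈η₂₄)`: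

* (T1) `((2πi)⁻¹x′ + φ₄₈·2y)/q⁶ → 0` ⟹ `x′ = −2πiφ₄₈·2y` (Sturm at `48`, `NewformFortyEight.cuspForm_fortyEight_eq_zero_of_tendsto`);
* (T2) `((2πi)⁻¹y′ + φ₄₈(3x² − 4x − 3))/q⁶ → 0` ⟹ `y′ = −2πiφ₄₈(3x² − 4x − 3)`;
* the two derivative identities and (T3) `x³ − 2x² − 3x − y² → 0` ⟹ `y² = x³ − 2x² − 3x` (the derivative of the cubic relation
  vanishes identically on `ℍ`, and it tends to `0`);
* non-degeneracy and the analytic bridge on `X = x − ⅔` (`(X′)² = (2πiφ₄₈)²(4X³ − (52/3)X − 280/27)`) ⟹ **(S2)₄₈**.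

HONEST FRAMING: hypotheses (T1)–(T3) only (discharged in `…EtaIdentitiesFortyEight`); nothing here proves C2, Manin's conjecture or
BSD.  No definition, no named fact, no sorry. [cite: Ligozat1975, Ch. 4] [cite: CremonaAlgorithms1997, Table 1 (48a1), §2.10]
-/

set_option autoImplicit false
-- lint-debt: the directory name repeats the summit name (sibling precedent `ManinLocalTwoThreeEtaIdentityReductionFortyEight.lean`)
set_option linter.dupNamespace false

noncomputable section

open Complex Filter Topology Set Function Asymptotics
open UpperHalfPlane hiding I
open scoped Real Topology Manifold MatrixGroups ModularForm
open ModularForm CongruenceSubgroup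
open Literature.NumberTheory.EllipticCurves Literature.NumberTheory.EllipticCurves.ModularForms

namespace Summit.BirchSwinnertonDyer.BirchSwinnertonDyer.Theorems.ManinLocalTwoThree.EtaIdentityReductionFortyEight

open CuspToolkit AnalyticBridge EtaIdentityReductionThirtySix NewformFortyEight

section Phi

variable (φ : CuspForm (Gamma0 48) 2)
  (hφ : ⇑φ = etaQuotient 48 (expFn [(2, -1), (4, 4), (6, -1), (8, -1), (12, 4), (24, -1)]))
include hφ

/-! ## §3 The three limits ⟹ the identities ⟹ (S2)₄₈ -/

/-- **(I2a) from (T1)**: `x′ = −2πi φ₄₈ · 2y` on `ℍ`. [cite: Ligozat1975, Ch. 4] -/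
theorem deriv_x48_of_tendsto
    (hT1 : Tendsto (fun τ : ℍ ↦ ((2 * π * I)⁻¹
      * deriv (etaQuotient 48 (expFn [(4, -2), (8, 4), (12, 2), (24, -4)]) ∘ ofComplex) τ
      + φ τ * (2 * etaQuotient 48 (expFn [(2, 1), (4, -2), (6, 1), (8, 3), (12, 2), (24, -5)]) τ))
      / Function.Periodic.qParam 1 (τ : ℂ) ^ 6) atImInfty (𝓝 0)) :
    ∀ τ : ℍ, deriv (etaQuotient 48 (expFn [(4, -2), (8, 4), (12, 2), (24, -4)]) ∘ ofComplex) τ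
      = -(2 * π * I * φ τ)
          * (2 * etaQuotient 48 (expFn [(2, 1), (4, -2), (6, 1), (8, 3), (12, 2), (24, -5)]) τ) := by
  have hq : Tendsto (fun τ : ℍ ↦ Function.Periodic.qParam 1 (τ : ℂ) ^ 6) atImInfty (𝓝 0) := by
    simpa only [zpow_natCast] using tendsto_qParam_zpow_atImInfty (m := ((6 : ℕ) : ℤ)) (by norm_num)
  have h0 := hT1.mul hq
  rw [zero_mul] at h0
  refine deriv_eq_of_tendsto_pow_of φ 6 (by norm_num) (fun S hS ↦ cuspForm_fortyEight_eq_zero_of_tendsto S hS) _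
    (fun τ ↦ 2 * etaQuotient 48 (expFn [(2, 1), (4, -2), (6, 1), (8, 3), (12, 2), (24, -5)]) τ)
    (mdifferentiable_etaQuotient 48 _) ((mdifferentiable_etaQuotient 48 _).const_smul (2 : ℂ)) x48_smul
    (fun γ hγ τ ↦ by simp only [y48_smul γ hγ τ]) (isZeroAtImInfty_slash_R1 φ hφ ?_) hT1
  refine (h0.congr fun τ ↦ ?_)
  exact div_mul_cancel₀ _ (pow_ne_zero _ (Complex.exp_ne_zero _))

/-- **(I2b) from (T2)**: `y′ = −2πi φ₄₈ · (3x² − 4x − 3)` on `ℍ`. [cite: Ligozat1975, Ch. 4] -/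
theorem deriv_y48_of_tendsto
    (hT2 : Tendsto (fun τ : ℍ ↦ ((2 * π * I)⁻¹
      * deriv (etaQuotient 48 (expFn [(2, 1), (4, -2), (6, 1), (8, 3), (12, 2), (24, -5)]) ∘ ofComplex) τ
      + φ τ * (3 * etaQuotient 48 (expFn [(4, -2), (8, 4), (12, 2), (24, -4)]) τ ^ 2
        - 4 * etaQuotient 48 (expFn [(4, -2), (8, 4), (12, 2), (24, -4)]) τ - 3))
      / Function.Periodic.qParam 1 (τ : ℂ) ^ 6) atImInfty (𝓝 0)) :
    ∀ τ : ℍ, deriv (etaQuotient 48 (expFn [(2, 1), (4, -2), (6, 1), (8, 3), (12, 2), (24, -5)]) ∘ ofComplex) τ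
      = -(2 * π * I * φ τ)
          * (3 * etaQuotient 48 (expFn [(4, -2), (8, 4), (12, 2), (24, -4)]) τ ^ 2
            - 4 * etaQuotient 48 (expFn [(4, -2), (8, 4), (12, 2), (24, -4)]) τ - 3) := by
  have hq : Tendsto (fun τ : ℍ ↦ Function.Periodic.qParam 1 (τ : ℂ) ^ 6) atImInfty (𝓝 0) := by
    simpa only [zpow_natCast] using tendsto_qParam_zpow_atImInfty (m := ((6 : ℕ) : ℤ)) (by norm_num)
  have h0 := hT2.mul hq
  rw [zero_mul] at h0
  refine deriv_eq_of_tendsto_pow_of φ 6 (by norm_num) (fun S hS ↦ cuspForm_fortyEight_eq_zero_of_tendsto S hS) _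
    (fun τ ↦ 3 * etaQuotient 48 (expFn [(4, -2), (8, 4), (12, 2), (24, -4)]) τ ^ 2
      - 4 * etaQuotient 48 (expFn [(4, -2), (8, 4), (12, 2), (24, -4)]) τ - 3)
    (mdifferentiable_etaQuotient 48 _) ?_ y48_smul (fun γ hγ τ ↦ by simp only [x48_smul γ hγ τ])
    (isZeroAtImInfty_slash_R2 φ hφ ?_) hT2
  · exact ((((mdifferentiable_etaQuotient 48 _).pow 2).const_smul (3 : ℂ)).sub
      ((mdifferentiable_etaQuotient 48 _).const_smul (4 : ℂ))).sub mdifferentiable_const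
  · refine (h0.congr fun τ ↦ ?_)
    exact div_mul_cancel₀ _ (pow_ne_zero _ (Complex.exp_ne_zero _))

omit hφ in
/-- **(I1) from (I2a), (I2b), (T3)**: `x³ − 2x² − 3x = y²` on `ℍ`. [cite: Ligozat1975, Ch. 4] -/
theorem cubic48_of_deriv
    (hx : ∀ τ : ℍ, deriv (etaQuotient 48 (expFn [(4, -2), (8, 4), (12, 2), (24, -4)]) ∘ ofComplex) τ
      = -(2 * π * I * φ τ)
          * (2 * etaQuotient 48 (expFn [(2, 1), (4, -2), (6, 1), (8, 3), (12, 2), (24, -5)]) τ))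
    (hy : ∀ τ : ℍ, deriv (etaQuotient 48 (expFn [(2, 1), (4, -2), (6, 1), (8, 3), (12, 2), (24, -5)]) ∘ ofComplex) τ
      = -(2 * π * I * φ τ)
          * (3 * etaQuotient 48 (expFn [(4, -2), (8, 4), (12, 2), (24, -4)]) τ ^ 2
            - 4 * etaQuotient 48 (expFn [(4, -2), (8, 4), (12, 2), (24, -4)]) τ - 3))
    (hT3 : Tendsto (fun τ : ℍ ↦ etaQuotient 48 (expFn [(4, -2), (8, 4), (12, 2), (24, -4)]) τ ^ 3
      - 2 * etaQuotient 48 (expFn [(4, -2), (8, 4), (12, 2), (24, -4)]) τ ^ 2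
      - 3 * etaQuotient 48 (expFn [(4, -2), (8, 4), (12, 2), (24, -4)]) τ
      - etaQuotient 48 (expFn [(2, 1), (4, -2), (6, 1), (8, 3), (12, 2), (24, -5)]) τ ^ 2) atImInfty (𝓝 0)) :
    ∀ τ : ℍ, etaQuotient 48 (expFn [(4, -2), (8, 4), (12, 2), (24, -4)]) τ ^ 3
      - 2 * etaQuotient 48 (expFn [(4, -2), (8, 4), (12, 2), (24, -4)]) τ ^ 2
      - 3 * etaQuotient 48 (expFn [(4, -2), (8, 4), (12, 2), (24, -4)]) τ
      = etaQuotient 48 (expFn [(2, 1), (4, -2), (6, 1), (8, 3), (12, 2), (24, -5)]) τ ^ 2 := by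
  set X : ℍ → ℂ := etaQuotient 48 (expFn [(4, -2), (8, 4), (12, 2), (24, -4)]) with hX
  set Y : ℍ → ℂ := etaQuotient 48 (expFn [(2, 1), (4, -2), (6, 1), (8, 3), (12, 2), (24, -5)]) with hY
  have hXd := UpperHalfPlane.mdifferentiable_iff.mp (mdifferentiable_etaQuotient 48 (expFn [(4, -2), (8, 4), (12, 2), (24, -4)]))
  have hYd := UpperHalfPlane.mdifferentiable_iff.mp
    (mdifferentiable_etaQuotient 48 (expFn [(2, 1), (4, -2), (6, 1), (8, 3), (12, 2), (24, -5)]))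
  have hderiv : ∀ z ∈ {z : ℂ | 0 < z.im}, deriv (fun z : ℂ ↦ (X ∘ ofComplex) z ^ 3 - 2 * (X ∘ ofComplex) z ^ 2
      - 3 * (X ∘ ofComplex) z - (Y ∘ ofComplex) z ^ 2) z = 0 := by
    intro z hz
    have h1 : HasDerivAt (X ∘ ofComplex) (deriv (X ∘ ofComplex) z) z :=
      ((hXd z hz).differentiableAt (isOpen_upperHalfPlaneSet.mem_nhds hz)).hasDerivAt
    have h2 : HasDerivAt (Y ∘ ofComplex) (deriv (Y ∘ ofComplex) z) z :=
      ((hYd z hz).differentiableAt (isOpen_upperHalfPlaneSet.mem_nhds hz)).hasDerivAt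
    have hPd := (((h1.pow 3).sub ((h1.pow 2).const_mul 2)).sub (h1.const_mul 3)).sub (h2.pow 2)
    have hfun : (fun z : ℂ ↦ (X ∘ ofComplex) z ^ 3 - 2 * (X ∘ ofComplex) z ^ 2 - 3 * (X ∘ ofComplex) z - (Y ∘ ofComplex) z ^ 2)
        = (((X ∘ ofComplex ^ 3 - fun v ↦ 2 * (X ∘ ofComplex ^ 2) v) - fun v ↦ 3 * (X ∘ ofComplex) v) - Y ∘ ofComplex ^ 2) := by
      funext w
      simp only [Pi.sub_apply, Pi.pow_apply]
    rw [hfun, hPd.deriv]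
    have hx' := hx ⟨z, hz⟩
    have hy' := hy ⟨z, hz⟩
    have hcoe : ((⟨z, hz⟩ : ℍ) : ℂ) = z := rfl
    rw [hcoe] at hx' hy'
    simp only [Function.comp_apply, ofComplex_apply_of_im_pos hz]
    rw [hx', hy', show (3 : ℕ) - 1 = 2 from rfl, show (2 : ℕ) - 1 = 1 from rfl]
    push_cast
    ring
  have hPdiff : DifferentiableOn ℂ (fun z : ℂ ↦ (X ∘ ofComplex) z ^ 3 - 2 * (X ∘ ofComplex) z ^ 2
      - 3 * (X ∘ ofComplex) z - (Y ∘ ofComplex) z ^ 2) {z : ℂ | 0 < z.im} :=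
    (((hXd.pow 3).sub ((hXd.pow 2).const_mul 2)).sub (hXd.const_mul 3)).sub (hYd.pow 2)
  have hconst : ∀ z ∈ {z : ℂ | 0 < z.im}, ∀ w ∈ {z : ℂ | 0 < z.im},
      (fun z : ℂ ↦ (X ∘ ofComplex) z ^ 3 - 2 * (X ∘ ofComplex) z ^ 2 - 3 * (X ∘ ofComplex) z - (Y ∘ ofComplex) z ^ 2) z
        = (fun z : ℂ ↦ (X ∘ ofComplex) z ^ 3 - 2 * (X ∘ ofComplex) z ^ 2 - 3 * (X ∘ ofComplex) z - (Y ∘ ofComplex) z ^ 2) w :=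
    fun z hz w hw ↦ isOpen_upperHalfPlaneSet.is_const_of_deriv_eq_zero
      convex_setOf_im_pos.isPreconnected hPdiff hderiv hz hw
  intro τ
  have hlim : Tendsto (fun σ : ℍ ↦ X σ ^ 3 - 2 * X σ ^ 2 - 3 * X σ - Y σ ^ 2) atImInfty
      (𝓝 (X τ ^ 3 - 2 * X τ ^ 2 - 3 * X τ - Y τ ^ 2)) := by
    refine tendsto_const_nhds.congr fun σ ↦ ?_
    have h := hconst _ τ.im_pos _ σ.im_pos
    simp only [Function.comp_apply, ofComplex_apply] at h
    exact h
  have h0 : X τ ^ 3 - 2 * X τ ^ 2 - 3 * X τ - Y τ ^ 2 = 0 := tendsto_nhds_unique hlim hT3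
  linear_combination h0

omit hφ in
/-- `x · q² → 1` at `i∞`. [folklore] -/
theorem tendsto_x48_mul_qParam_sq :
    Tendsto (fun τ : ℍ ↦ etaQuotient 48 (expFn [(4, -2), (8, 4), (12, 2), (24, -4)]) τ
      * Function.Periodic.qParam 1 (τ : ℂ) ^ (2 : ℤ)) atImInfty (𝓝 1) := by
  have h := tendsto_etaQuotient_div_qParam_zpow 48 (expFn [(4, -2), (8, 4), (12, 2), (24, -4)]) (-2) (by decide)
  refine h.congr fun τ ↦ ?_
  rw [zpow_neg, div_inv_eq_mul]

omit hφ in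
/-- Non-degeneracy on `X = x − ⅔`: `4X³ − (52/3)X − 280/27 = 4(x³ − 2x² − 3x)` is not identically `0`
(else `(xq²)³ → 1` contradicts `x³q⁶ = (2x² + 3x)q⁶ → 0`). [folklore] -/
theorem exists_x48_nondegenerate :
    ∃ τ₀ : ℍ, 4 * (etaQuotient 48 (expFn [(4, -2), (8, 4), (12, 2), (24, -4)]) τ₀ - 2 / 3) ^ 3
      - 52 / 3 * (etaQuotient 48 (expFn [(4, -2), (8, 4), (12, 2), (24, -4)]) τ₀ - 2 / 3) - 280 / 27 ≠ 0 := by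
  by_contra hne
  push Not at hne
  have hx3 : ∀ τ : ℍ, etaQuotient 48 (expFn [(4, -2), (8, 4), (12, 2), (24, -4)]) τ ^ 3
      = 2 * etaQuotient 48 (expFn [(4, -2), (8, 4), (12, 2), (24, -4)]) τ ^ 2
        + 3 * etaQuotient 48 (expFn [(4, -2), (8, 4), (12, 2), (24, -4)]) τ :=
    fun τ ↦ by linear_combination (1 / 4 : ℂ) * hne τ
  have hq := tendsto_qParam_zpow_atImInfty (m := 2) (by norm_num)
  have hxq := tendsto_x48_mul_qParam_sq
  have h1 : Tendsto (fun τ : ℍ ↦ (etaQuotient 48 (expFn [(4, -2), (8, 4), (12, 2), (24, -4)]) τ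
      * Function.Periodic.qParam 1 (τ : ℂ) ^ (2 : ℤ)) ^ 3) atImInfty (𝓝 1) := by
    simpa using hxq.pow 3
  have h2 : Tendsto (fun τ : ℍ ↦ (etaQuotient 48 (expFn [(4, -2), (8, 4), (12, 2), (24, -4)]) τ
      * Function.Periodic.qParam 1 (τ : ℂ) ^ (2 : ℤ)) ^ 3) atImInfty (𝓝 0) := by
    have h := (((hxq.pow 2).mul hq).const_mul 2).add ((((hxq.const_mul 3).mul hq).mul hq))
    simp only [one_pow, mul_zero, add_zero] at h
    refine h.congr fun τ ↦ ?_
    rw [mul_pow _ _ 3, hx3]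
    ring
  exact one_ne_zero (tendsto_nhds_unique h1 h2)

/-- **(S2)₄₈ from (I1), (I2a)**: the period lattice of `φ₄₈` lies in the lattice of the Weierstrass pair with invariants
`g₂ = 52/3 = c₄/12`, `g₃ = 280/27 = c₆/216` of `[0, −2, 0, −3, 0] ≅ 48a1` (analytic bridge on `X = x − ⅔`).
[cite: CremonaAlgorithms1997, §2.10, Table 1 (48a1)] -/
theorem periodLatticeLe48_of_etaIdentities
    (h1 : ∀ τ : ℍ, etaQuotient 48 (expFn [(4, -2), (8, 4), (12, 2), (24, -4)]) τ ^ 3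
      - 2 * etaQuotient 48 (expFn [(4, -2), (8, 4), (12, 2), (24, -4)]) τ ^ 2
      - 3 * etaQuotient 48 (expFn [(4, -2), (8, 4), (12, 2), (24, -4)]) τ
      = etaQuotient 48 (expFn [(2, 1), (4, -2), (6, 1), (8, 3), (12, 2), (24, -5)]) τ ^ 2)
    (h2 : ∀ τ : ℍ, deriv (etaQuotient 48 (expFn [(4, -2), (8, 4), (12, 2), (24, -4)]) ∘ ofComplex) τ
      = -(2 * π * I * φ τ)
          * (2 * etaQuotient 48 (expFn [(2, 1), (4, -2), (6, 1), (8, 3), (12, 2), (24, -5)]) τ)) :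
    ∃ L₁ : PeriodPair, L₁.g₂ = 52 / 3 ∧ L₁.g₃ = 280 / 27 ∧ ∀ z ∈ periodLattice φ, z ∈ L₁.lattice := by
  obtain ⟨L₁, hg2, hg3⟩ := PeriodPair.uniformization_holds (52 / 3) (280 / 27) (by norm_num)
  have hmd : MDifferentiable 𝓘(ℂ) 𝓘(ℂ) (fun τ : ℍ ↦ etaQuotient 48 (expFn [(4, -2), (8, 4), (12, 2), (24, -4)]) τ - 2 / 3) :=
    (mdifferentiable_etaQuotient 48 _).sub mdifferentiable_const
  refine ⟨L₁, hg2, hg3, periodLattice_le_of_deriv_sq φ (phi48_ne_zero φ hφ) L₁ _ hmd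
    (fun γ τ ↦ by simp only [x48_smul γ γ.2 τ]) ?_ (by rw [hg2, hg3]; exact exists_x48_nondegenerate)⟩
  intro τ
  have hderiv : deriv ((fun σ : ℍ ↦ etaQuotient 48 (expFn [(4, -2), (8, 4), (12, 2), (24, -4)]) σ - 2 / 3) ∘ ofComplex) τ
      = deriv (etaQuotient 48 (expFn [(4, -2), (8, 4), (12, 2), (24, -4)]) ∘ ofComplex) τ := by
    rw [show ((fun σ : ℍ ↦ etaQuotient 48 (expFn [(4, -2), (8, 4), (12, 2), (24, -4)]) σ - 2 / 3) ∘ ofComplex)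
      = fun z ↦ (etaQuotient 48 (expFn [(4, -2), (8, 4), (12, 2), (24, -4)]) ∘ ofComplex) z - 2 / 3 from rfl, deriv_sub_const]
  rw [hderiv, h2 τ, hg2, hg3]
  linear_combination 4 * (2 * π * I * φ τ) ^ 2 * (h1 τ).symm

end Phi

end Summit.BirchSwinnertonDyer.BirchSwinnertonDyer.Theorems.ManinLocalTwoThree.EtaIdentityReductionFortyEight

end
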